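import Literature.AnabelianGeometry.EtaleTheta.SettingModelBTorsionTowerTransport
import HarnessLib

/-!
# THEOREM R1 (R1a) from (PBF): `ThetaFixedRigidity p` (ROUTE-PBF file T1)

PROOF-ONLY.  `thetaFixedRigidity_of_permBasisFixedPoints : PermBasisFixedPoints → ThetaFixedRigidity p`.
Classical profinite group theory about OUR semi-synthetic `F₂hatT`; CONDITIONAL (where stated) on the displayed
tree-free hypothesis `PermBasisFixedPoints`; nothing about [EtTh]/[IUTchII]/[IUTchIII] in print; no side on
[IUTchIII] Cor 3.12; nothing here asserts abc proved or refuted.  abc-iut-L6-t19 gen 22 (ROUTE-PBF, rung (L3′) slice 1).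
-/

noncomputable section

namespace Literature.AnabelianGeometry.EtaleTheta.SettingModel.BTorsionTower

open Literature.AnabelianGeometry.EtaleTheta.SettingModel
open Literature.AnabelianGeometry.EtaleTheta (ZHatLevel.level ZHatLevel.levelChar)
open Literature.AnabelianGeometry.SemiGraphs
open Literature.AnabelianGeometry.AbsoluteAnabelian
open Literature.IUT.HodgeTheaters (profiniteCompletion toCompletion)
open CategoryTheory
open Literature.AnabelianGeometry.EtaleTheta.SettingModel.TreeFree (permHat PermBasisFixedPoints permHat_toCompletion)

section Assembly

variable (p : ℕ) [Fact p.Prime]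

/-- **THEOREM R1 (R1a) of PL3-R1A, from (PBF) alone**: every element of `F̂₂` fixed by all the cyclotomic
twists `θ_{χ(σ)}`, `σ ∈ G_{ℚ_p}`, is a `Ẑ`-power of `a` — `ThetaFixedRigidity p`.  Route: the b-torsion tower
(L1)–(L4) + the transported (PBF); no profinite tree. [cite: MochizukiEtTh2009, §1 p.12] -/
theorem thetaFixedRigidityOn_of_permBasisFixedPoints (hPBF : PermBasisFixedPoints.{0})
    (U : Subgroup (GQp p)) [U.FiniteIndex] (w : F₂hatT) (hw : ∀ σ ∈ U, twist (chi p σ) w = w) :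
    ∃ s : ZH, w = powHat (eta (FreeGroup.of 0)) s := by
  classical
  -- it suffices to see `w` in the closure of `η(⟨x₀⟩)`, level by level
  suffices hcl : w ∈ closure (eta '' (Subgroup.zpowers (FreeGroup.of 0 : F₂) : Set F₂)) by
    have hrange : IsClosed (Set.range (powHat (eta (FreeGroup.of 0)))) :=
      (isCompact_range (powHat _).continuous).isClosed
    have hsub : eta '' (Subgroup.zpowers (FreeGroup.of 0 : F₂) : Set F₂) ⊆
        Set.range (powHat (eta (FreeGroup.of 0))) := by
      rintro _ ⟨g, ⟨k, rfl⟩, rfl⟩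
      refine ⟨iotaZ (Multiplicative.ofAdd k), ?_⟩
      rw [powHat_iotaZ, toAdd_ofAdd, map_zpow]
    obtain ⟨s, hs⟩ := (hrange.closure_subset_iff.2 hsub) hcl
    exact ⟨s, hs.symm⟩
  refine Literature.IUT.HodgeTheaters.ProfiniteCompletion.mem_closure_image_of_forall_val_mem fun M => ?_
  -- the finite quotient `ψ = F̂₂ → F₂/M` and the order `N` of `ψ(b)`
  haveI : DiscreteTopology ((ProfiniteGrp.ProfiniteCompletion.diagram (GrpCat.of F₂)).obj M) := ⟨rfl⟩
  haveI : Finite ((ProfiniteGrp.ProfiniteCompletion.diagram (GrpCat.of F₂)).obj M) :=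
    inferInstanceAs (Finite (F₂ ⧸ M.toSubgroup))
  let ψ := levelMap M
  set A := ψ (eta (FreeGroup.of 0)) with hA
  set B := ψ (eta (FreeGroup.of 1)) with hB
  let N : ℕ+ := ⟨orderOf B, orderOf_pos B⟩
  -- an adapted level `n`
  obtain ⟨n, hNn, had⟩ := exists_adapted p U N
  have hψ : ψ (eta (FreeGroup.of 1)) ^ (n : ℕ) = 1 := by
    rw [← hB]
    exact orderOf_dvd_iff_pow_eq_one.1 hNn
  -- fixed residues are killed by `ψ(b)`
  have hBpow : ∀ i : ZMod n, (∀ σ ∈ U, ZHatLevel.levelChar n (chi p σ) * i = i) →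
      rotPart n ψ hψ (Multiplicative.ofAdd i) = 1 := by
    intro i hi
    haveI : NeZero (n : ℕ) := ⟨n.ne_zero⟩
    have hdvd := dvd_val_of_fixed p U had hi
    have h := rotPart_ofAdd_intCast n ψ hψ (i.val : ℤ)
    rw [Int.cast_natCast, ZMod.natCast_zmod_val, zpow_natCast] at h
    rw [h, ← hB]
    exact orderOf_dvd_iff_pow_eq_one.1 hdvd
  -- the image `q = φ_n(w)` is fixed by the `k̂_{χ_n(σ),0}`
  set q := phi n w with hq
  have hqfix : ∀ σ ∈ U, affHat n (ZHatLevel.levelChar n (chi p σ)) 0 q = q := fun σ hσ => by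
    rw [hq, ← phi_twist, hw σ hσ]
  -- decomposition `q = η_Λ(inr c) · ν'` with `ν' ∈ N̂`
  haveI : (Glet n).FiniteIndex := finiteIndex_Glet n
  obtain ⟨f, hf⟩ := Literature.IUT.HodgeTheaters.ProfiniteCompletion.exists_inv_mul_mem_closure (Glet n) q
  set c := f.right with hc
  set ν' := (etaL n (SemidirectProduct.inr c))⁻¹ * q with hν'
  have hν'mem : ν' ∈ NhatSub n := by
    have hμ : (etaL n f)⁻¹ * q ∈ NhatSub n := by
      rw [← SetLike.mem_coe, coe_NhatSub]; exact hf
    have hf' : etaL n f = etaL n (SemidirectProduct.inl f.left) * etaL n (SemidirectProduct.inr c) := by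
      rw [← map_mul, hc, SemidirectProduct.inl_left_mul_inr_right]
    have hν'eq : ν' = ((etaL n (SemidirectProduct.inr c))⁻¹ * etaL n (SemidirectProduct.inl f.left) *
        etaL n (SemidirectProduct.inr c)) * ((etaL n f)⁻¹ * q) := by
      rw [hν', hf']; group
    rw [hν'eq]
    exact (NhatSub n).mul_mem (conj_inr_mem_NhatSub n c (etaL_inl_mem_NhatSub n f.left)) hμ
  have hqdec : q = etaL n (SemidirectProduct.inr c) * ν' := by rw [hν']; group
  -- `c` is fixed by the `χ_n(σ)` and `ν'` by the `k̂`
  obtain ⟨π, hπη, hπN, hπaff⟩ := exists_projC n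
  have hπq : π q = c := by
    rw [hqdec, map_mul, hπη, SemidirectProduct.rightHom_inr, hπN ν' hν'mem, mul_one]
  have hcfix : ∀ σ ∈ U, ZHatLevel.levelChar n (chi p σ) * Multiplicative.toAdd c = Multiplicative.toAdd c := by
    intro σ hσ
    have h := hπaff (ZHatLevel.levelChar n (chi p σ)) 0 q
    rw [hqfix σ hσ, hπq, affRot_apply] at h
    have h2 := congrArg Multiplicative.toAdd h
    rw [toAdd_ofAdd] at h2
    exact h2.symm
  have hν'fix : ∀ σ ∈ U, affHat n (chiUnit p n σ) 0 ν' = ν' := by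
    intro σ hσ
    rw [coe_chiUnit, hν', map_mul, map_inv, affHat_etaL, aff_inr, affRot_apply, hcfix σ hσ, ofAdd_toAdd, hqfix σ hσ]
  -- (PBF), transported
  have hν'cl := mem_closure_fixedLetters_of_PBF n hPBF (chiUnit p n '' U)
    (by rw [← coe_NhatSub]; exact hν'mem) (by rintro _ ⟨σ, hσ, rfl⟩; exact hν'fix σ hσ)
  -- apply `ρ`: the fixed letters go to `A`, `c` goes to `1`
  let ρ := rho n ψ hψ
  have hfixed_of_mem : ∀ i : ZMod n, (∀ u ∈ chiUnit p n '' U, (u : ZMod n) * i = i) →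
      ∀ σ ∈ U, ZHatLevel.levelChar n (chi p σ) * i = i := by
    intro i hi σ hσ
    exact hi (chiUnit p n σ) ⟨σ, hσ, rfl⟩
  have hK : (Subgroup.closure (FreeGroup.of '' {i : ZMod n | ∀ u ∈ chiUnit p n '' U, (u : ZMod n) * i = i})).map
      (letterPart n ψ hψ) ≤ Subgroup.zpowers A := by
    rw [Subgroup.map_le_iff_le_comap, Subgroup.closure_le]
    rintro _ ⟨i, hi, rfl⟩
    rw [SetLike.mem_coe, Subgroup.mem_comap, letterPart_of, hBpow i (hfixed_of_mem i hi), one_mul, inv_one,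
      mul_one, ← hA]
    exact Subgroup.mem_zpowers A
  have hρν' : ρ ν' ∈ Subgroup.zpowers A := by
    have himg : ρ ν' ∈ closure (ρ '' (etaL n '' (SemidirectProduct.inl ''
        (Subgroup.closure (FreeGroup.of '' {i : ZMod n | ∀ u ∈ chiUnit p n '' U, (u : ZMod n) * i = i}) :
          Set (FreeGroup (ZMod n)))))) :=
      image_closure_subset_closure_image ρ.continuous ⟨ν', hν'cl, rfl⟩
    have hcl : IsClosed ((Subgroup.zpowers A : Set ((ProfiniteGrp.ProfiniteCompletion.diagram (GrpCat.of F₂)).obj M))) :=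
      isClosed_discrete _
    refine (hcl.closure_subset_iff.2 ?_) himg
    rintro _ ⟨_, ⟨_, ⟨g, hg, rfl⟩, rfl⟩, rfl⟩
    change ρ (etaL n (SemidirectProduct.inl g)) ∈ Subgroup.zpowers A
    rw [show ρ (etaL n (SemidirectProduct.inl g)) = lamPart n ψ hψ (SemidirectProduct.inl g) from rho_etaL n ψ hψ _,
      lamPart, SemidirectProduct.lift_inl]
    exact hK ⟨g, hg, rfl⟩
  have hρc : ρ (etaL n (SemidirectProduct.inr c)) = 1 := by
    rw [show ρ (etaL n (SemidirectProduct.inr c)) = lamPart n ψ hψ (SemidirectProduct.inr c) from rho_etaL n ψ hψ _,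
      lamPart_inr, ← ofAdd_toAdd c]
    exact hBpow _ hcfix
  -- conclusion at level `M`
  have hψw : ψ w ∈ Subgroup.zpowers A := by
    rw [show ψ w = ρ q from (rho_phi n ψ hψ w).symm, hqdec, map_mul, hρc, one_mul]
    exact hρν'
  change (levelMap M) w ∈ (Subgroup.zpowers (FreeGroup.of 0 : F₂)).map (QuotientGroup.mk' M.toSubgroup)
  rw [MonoidHom.map_zpowers]
  exact hψw

/-- **THEOREM R1 (R1a) of PL3-R1A, from (PBF) alone**: `ThetaFixedRigidity p` (the case `U = G_{ℚ_p}`).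
[cite: MochizukiEtTh2009, §1 p.12] -/
theorem thetaFixedRigidity_of_permBasisFixedPoints (hPBF : PermBasisFixedPoints.{0}) : ThetaFixedRigidity p :=
  fun w hw => thetaFixedRigidityOn_of_permBasisFixedPoints p hPBF ⊤ w fun σ _ => hw σ
end Assembly

end Literature.AnabelianGeometry.EtaleTheta.SettingModel.BTorsionTower

end
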